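import Summits.Parity.GeneralizedHardyLittlewood.Theorems.ChenParityOracleBLAPHostParityFromBrickTypeIIHyperbolic
import Literature.NumberTheory.LFunctions.MatomakiRadziwillTaoMajorArc
import HarnessLib

/-!
# Route `ChenParityOracleBLAP` — crux S1 = `HostParityFromBrick` (stmt-Parity-20045): uniform form of the hyperbolic Type-II bound

Support file for the prime half `K1 → K2 → HP1` of S1 (step (F2)).  With `L = log x`,
`ρ = 1 + L^{−34}` and the K1/K2 bodies at exponent `A = 90` for this `x`, the right-hand side of
`typeII_hyperbolic_static` is bounded uniformly in the dyadic variable `M ≤ x^{2/3}/2`, the height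
`y ≤ x` and the cut `V₀` by
`X₂*(x) = 45 x/L^{18} + K₀ (x/L^7 + x^{1−δ/2} L^{10})`, `K₀ = 2^{14} √(C_τ + 1)`
(`typeII_rhs_le_uniform`), giving the hypothesis `HTII` of `level_vonMangoldt_static` on any
`Dset ⊆ [1, x^{1/2−ε}]` (`HTII_of_K`).

References: H. Iwaniec, E. Kowalski, *Analytic Number Theory* (2004), §13.4, §17.3
[IwaniecKowalski2004].
-/

namespace Summit.Parity.GeneralizedHardyLittlewood.Theorems

open Finset Real
open scoped ArithmeticFunction.sigma
open ArithmeticFunction (liouville sigma)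

set_option maxHeartbeats 400000 in
/-- **Uniform form of the hyperbolic Type-II right-hand side.**  For `x ≥ 16` (so `L = log x ≥ 1`),
`ρ = 1 + L^{−34}`, `0 < δ ≤ 1/3`, `1 ≤ M`, `2M ≤ x^{2/3}`, `y ≤ x`, `0 ≤ C_τ`:
`classes · (1+(1+L)²) x/L^{90} + √(4(ρ−1)y + M + 4ρ²x^{1−δ}) √(C_τ (y+2) log(y+2)^{20})`
`≤ 45 x/L^{18} + 2^{14}√(C_τ+1) (x/L^7 + x^{1−δ/2} L^{10})`. -/
theorem typeII_rhs_le_uniform {x M y : ℕ} (hx : (16 : ℝ) ≤ x) {δ Cτ : ℝ} (hδ0 : 0 < δ) (hδ : δ ≤ 1 / 3)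
    (hCτ : 0 ≤ Cτ) (hM : 1 ≤ M) (hMhi : 2 * (M : ℝ) ≤ (x : ℝ) ^ (2 / 3 : ℝ)) (hyx : y ≤ x) :
    ((⌊Real.log (2 * M : ℕ) / Real.log (1 + (Real.log x) ^ (-(34 : ℝ)))⌋₊ + 1 : ℕ) : ℝ) *
        ((⌊Real.log y / Real.log (1 + (Real.log x) ^ (-(34 : ℝ)))⌋₊ + 1 : ℕ) : ℝ) *
        ((1 + (1 + Real.log x) ^ 2) * ((x : ℝ) / Real.log x ^ (90 : ℝ))) +
      Real.sqrt (4 * ((1 + (Real.log x) ^ (-(34 : ℝ))) - 1) * y + M +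
          4 * (1 + (Real.log x) ^ (-(34 : ℝ))) ^ 2 * (x : ℝ) ^ (1 - δ)) *
        Real.sqrt (Cτ * ((y : ℝ) + 2) * Real.log ((y : ℝ) + 2) ^ (20 : ℕ)) ≤
      45 * (x : ℝ) / Real.log x ^ (18 : ℝ) +
        2 ^ (14 : ℕ) * Real.sqrt (Cτ + 1) * ((x : ℝ) / Real.log x ^ (7 : ℝ) +
          (x : ℝ) ^ (1 - δ / 2) * Real.log x ^ (10 : ℝ)) := by
  have hx1 : (1 : ℝ) < x := by linarith
  have hx0 : (0 : ℝ) < x := by linarith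
  have hx2 : (2 : ℝ) ≤ x := by linarith
  set L : ℝ := Real.log x with hL
  have hL1 : 1 ≤ L := by
    rw [hL, ← Real.log_exp 1]
    refine Real.log_le_log (Real.exp_pos 1) ?_
    have := Real.exp_one_lt_d9; linarith
  have hL0 : 0 < L := by linarith
  set u : ℝ := L ^ (-(34 : ℝ)) with hu
  have hu0 : 0 < u := Real.rpow_pos_of_pos hL0 _
  have hu1 : u ≤ 1 := Real.rpow_le_one_of_one_le_of_nonpos hL1 (by norm_num)
  have hρ : 1 < 1 + u := by linarith
  have hρ2 : 1 + u ≤ 2 := by linarith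
  -- class counts: `⌊log t/log ρ⌋ + 1 ≤ 3 L^{35}` for `1 ≤ t ≤ x`
  have hcls : ∀ t : ℕ, 1 ≤ t → t ≤ x →
      ((⌊Real.log t / Real.log (1 + u)⌋₊ + 1 : ℕ) : ℝ) ≤ 3 * L ^ (35 : ℝ) := by
    intro t ht htx
    have h1 := floor_log_div_le hρ hρ2 ht
    rw [show (1 : ℝ) + u - 1 = u by ring] at h1
    have hlt : Real.log t ≤ L := Real.log_le_log (by exact_mod_cast ht) (by exact_mod_cast htx)
    have hlt0 : 0 ≤ Real.log t := Real.log_nonneg (by exact_mod_cast ht)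
    have h3 : L * L ^ (34 : ℝ) = L ^ (35 : ℝ) := by
      rw [← Real.rpow_one_add' hL0.le (by norm_num)]; norm_num
    have h2 : 2 * Real.log t / u ≤ 2 * L ^ (35 : ℝ) := by
      rw [hu, Real.rpow_neg hL0.le, div_inv_eq_mul, ← h3]
      have h34 : 0 ≤ L ^ (34 : ℝ) := by positivity
      nlinarith [mul_le_mul_of_nonneg_right hlt h34]
    have h35 : 1 ≤ L ^ (35 : ℝ) := Real.one_le_rpow hL1 (by norm_num)
    push_cast
    linarith [h1, h2, h35]
  have hM2x : ((2 * M : ℕ) : ℝ) ≤ x := by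
    push_cast
    refine hMhi.trans ?_
    calc (x : ℝ) ^ (2 / 3 : ℝ) ≤ (x : ℝ) ^ (1 : ℝ) := Real.rpow_le_rpow_of_exponent_le hx1.le (by norm_num)
      _ = x := Real.rpow_one _
  have hc1 := hcls (2 * M) (by omega) (by exact_mod_cast hM2x)
  have hc2 : ((⌊Real.log y / Real.log (1 + u)⌋₊ + 1 : ℕ) : ℝ) ≤ 3 * L ^ (35 : ℝ) := by
    rcases Nat.eq_zero_or_pos y with rfl | hy
    · simp only [Nat.cast_zero, Real.log_zero, zero_div, Nat.floor_zero, zero_add, Nat.cast_one]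
      have : 1 ≤ L ^ (35 : ℝ) := Real.one_le_rpow hL1 (by norm_num)
      linarith
    · exact hcls y hy hyx
  -- first term
  have hfirst : ((⌊Real.log (2 * M : ℕ) / Real.log (1 + u)⌋₊ + 1 : ℕ) : ℝ) *
      ((⌊Real.log y / Real.log (1 + u)⌋₊ + 1 : ℕ) : ℝ) * ((1 + (1 + L) ^ 2) * ((x : ℝ) / L ^ (90 : ℝ))) ≤
      45 * (x : ℝ) / L ^ (18 : ℝ) := by
    have h5 : 1 + (1 + L) ^ 2 ≤ 5 * L ^ (2 : ℝ) := by
      rw [show (2 : ℝ) = ((2 : ℕ) : ℝ) by norm_num, Real.rpow_natCast]; nlinarith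
    have h70 : L ^ (35 : ℝ) * L ^ (35 : ℝ) = L ^ (70 : ℝ) := by
      rw [← Real.rpow_add hL0]; norm_num
    have hprod : ((⌊Real.log (2 * M : ℕ) / Real.log (1 + u)⌋₊ + 1 : ℕ) : ℝ) *
        ((⌊Real.log y / Real.log (1 + u)⌋₊ + 1 : ℕ) : ℝ) ≤ 9 * L ^ (70 : ℝ) := by
      have := mul_le_mul hc1 hc2 (Nat.cast_nonneg _) (by positivity)
      calc _ ≤ 3 * L ^ (35 : ℝ) * (3 * L ^ (35 : ℝ)) := this
        _ = 9 * L ^ (70 : ℝ) := by rw [← h70]; ring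
    have hxL : 0 ≤ (x : ℝ) / L ^ (90 : ℝ) := by positivity
    calc _ ≤ 9 * L ^ (70 : ℝ) * (5 * L ^ (2 : ℝ) * ((x : ℝ) / L ^ (90 : ℝ))) :=
          mul_le_mul hprod (mul_le_mul_of_nonneg_right h5 hxL) (by positivity) (by positivity)
      _ = 45 * (x : ℝ) / L ^ (18 : ℝ) := by
          have e : L ^ (90 : ℝ) = L ^ (70 : ℝ) * L ^ (2 : ℝ) * L ^ (18 : ℝ) := by
            rw [← Real.rpow_add hL0, ← Real.rpow_add hL0]; norm_num
          rw [e]; field_simp; ring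
  -- second term
  have hlog2 : Real.log ((y : ℝ) + 2) ≤ 2 * L := by
    have hy2 : (y : ℝ) + 2 ≤ (x : ℝ) ^ 2 := by
      have : (y : ℝ) ≤ x := by exact_mod_cast hyx
      nlinarith
    calc Real.log ((y : ℝ) + 2) ≤ Real.log ((x : ℝ) ^ 2) := Real.log_le_log (by positivity) hy2
      _ = 2 * L := by rw [Real.log_pow]; push_cast; ring
  have hlog20 : 0 ≤ Real.log ((y : ℝ) + 2) := Real.log_nonneg (by linarith [Nat.cast_nonneg (α := ℝ) y])
  have hB : Cτ * ((y : ℝ) + 2) * Real.log ((y : ℝ) + 2) ^ (20 : ℕ) ≤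
      (Cτ + 1) * (2 ^ (21 : ℕ) * x * L ^ (20 : ℝ)) := by
    have h1 : Real.log ((y : ℝ) + 2) ^ (20 : ℕ) ≤ (2 * L) ^ (20 : ℕ) := pow_le_pow_left₀ hlog20 hlog2 _
    have h2 : (2 * L) ^ (20 : ℕ) = 2 ^ (20 : ℕ) * L ^ (20 : ℝ) := by
      rw [mul_pow, show (20 : ℝ) = ((20 : ℕ) : ℝ) by norm_num, Real.rpow_natCast]
    have h3 : (y : ℝ) + 2 ≤ 2 * x := by
      have : (y : ℝ) ≤ x := by exact_mod_cast hyx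
      linarith
    calc Cτ * ((y : ℝ) + 2) * Real.log ((y : ℝ) + 2) ^ (20 : ℕ)
        ≤ Cτ * (2 * x) * (2 ^ (20 : ℕ) * L ^ (20 : ℝ)) := by
          rw [← h2]; exact mul_le_mul (mul_le_mul_of_nonneg_left h3 hCτ) h1 (by positivity) (by positivity)
      _ ≤ (Cτ + 1) * (2 ^ (21 : ℕ) * x * L ^ (20 : ℝ)) := by
          have : 0 ≤ (2 : ℝ) ^ (21 : ℕ) * x * L ^ (20 : ℝ) := by positivity
          nlinarith
  have hA : 4 * ((1 + u) - 1) * y + M + 4 * (1 + u) ^ 2 * (x : ℝ) ^ (1 - δ) ≤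
      4 * u * x + 17 * (x : ℝ) ^ (1 - δ) := by
    have h1 : 4 * ((1 + u) - 1) * (y : ℝ) ≤ 4 * u * x := by
      have : (y : ℝ) ≤ x := by exact_mod_cast hyx
      nlinarith
    have h2 : (M : ℝ) ≤ (x : ℝ) ^ (1 - δ) := by
      have : (M : ℝ) ≤ (x : ℝ) ^ (2 / 3 : ℝ) := by linarith [show (0:ℝ) ≤ M from Nat.cast_nonneg M]
      exact this.trans (Real.rpow_le_rpow_of_exponent_le hx1.le (by linarith))
    have h3 : 4 * (1 + u) ^ 2 * (x : ℝ) ^ (1 - δ) ≤ 16 * (x : ℝ) ^ (1 - δ) := by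
      have : (1 + u) ^ 2 ≤ 4 := by nlinarith
      have h0 : 0 ≤ (x : ℝ) ^ (1 - δ) := by positivity
      nlinarith
    linarith
  have hsecond : Real.sqrt (4 * ((1 + u) - 1) * y + M + 4 * (1 + u) ^ 2 * (x : ℝ) ^ (1 - δ)) *
      Real.sqrt (Cτ * ((y : ℝ) + 2) * Real.log ((y : ℝ) + 2) ^ (20 : ℕ)) ≤
      2 ^ (14 : ℕ) * Real.sqrt (Cτ + 1) * ((x : ℝ) / L ^ (7 : ℝ) + (x : ℝ) ^ (1 - δ / 2) * L ^ (10 : ℝ)) := by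
    -- `√A ≤ 2 L^{-17} √x + 5 x^{(1-δ)/2}`
    have hsu : Real.sqrt u = L ^ (-(17 : ℝ)) := by
      rw [hu, Real.sqrt_eq_rpow, ← Real.rpow_mul hL0.le]; norm_num
    have hsx : Real.sqrt x * Real.sqrt x = (x : ℝ) := Real.mul_self_sqrt hx0.le
    have hsx' : Real.sqrt (x : ℝ) = (x : ℝ) ^ (1 / 2 : ℝ) := Real.sqrt_eq_rpow _
    have hux0 : 0 ≤ 4 * u * (x : ℝ) := by positivity
    have hxδ0 : 0 ≤ 17 * (x : ℝ) ^ (1 - δ) := by positivity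
    have hA1 : Real.sqrt (4 * u * x) = 2 * L ^ (-(17 : ℝ)) * Real.sqrt x := by
      have h4 : Real.sqrt (4 : ℝ) = 2 := by
        rw [show (4 : ℝ) = 2 ^ 2 by norm_num, Real.sqrt_sq (by norm_num)]
      rw [Real.sqrt_mul (by positivity), Real.sqrt_mul (by norm_num), hsu, h4]
    have hA2 : Real.sqrt (17 * (x : ℝ) ^ (1 - δ)) ≤ 5 * (x : ℝ) ^ ((1 - δ) / 2) := by
      have e : ((x : ℝ) ^ ((1 - δ) / 2)) ^ 2 = (x : ℝ) ^ (1 - δ) := by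
        rw [← Real.rpow_natCast, ← Real.rpow_mul hx0.le]; norm_num
      have ha : 0 ≤ (x : ℝ) ^ (1 - δ) := Real.rpow_nonneg hx0.le _
      have hsq : 17 * (x : ℝ) ^ (1 - δ) ≤ (5 * (x : ℝ) ^ ((1 - δ) / 2)) ^ 2 := by
        rw [mul_pow, e]
        norm_num
        linarith only [ha]
      calc Real.sqrt (17 * (x : ℝ) ^ (1 - δ)) ≤ Real.sqrt ((5 * (x : ℝ) ^ ((1 - δ) / 2)) ^ 2) :=
            Real.sqrt_le_sqrt hsq
        _ = 5 * (x : ℝ) ^ ((1 - δ) / 2) := Real.sqrt_sq (by positivity)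
    have hsA : Real.sqrt (4 * ((1 + u) - 1) * y + M + 4 * (1 + u) ^ 2 * (x : ℝ) ^ (1 - δ)) ≤
        2 * L ^ (-(17 : ℝ)) * Real.sqrt x + 5 * (x : ℝ) ^ ((1 - δ) / 2) := by
      have s1 := Real.sqrt_le_sqrt hA
      have s2 := Literature.NumberTheory.LFunctions.MRT2015.sqrt_add_le_sqrt_add_sqrt hux0 hxδ0
      rw [hA1] at s2
      linarith only [s1, s2, hA2]
    -- `√B ≤ 2^{11} √(Cτ+1) √x L^{10}`
    set T : ℝ := 2 ^ (11 : ℕ) * Real.sqrt (Cτ + 1) * Real.sqrt x * L ^ (10 : ℝ) with hT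
    have hT0 : 0 ≤ T := by positivity
    have hsB : Real.sqrt (Cτ * ((y : ℝ) + 2) * Real.log ((y : ℝ) + 2) ^ (20 : ℕ)) ≤ T := by
      have hT2 : (Cτ + 1) * (2 ^ (21 : ℕ) * x * L ^ (20 : ℝ)) ≤ T ^ 2 := by
        have e : T ^ 2 = 2 ^ (22 : ℕ) * (Cτ + 1) * x * L ^ (20 : ℝ) := by
          rw [hT]
          rw [show (2 ^ (11 : ℕ) * Real.sqrt (Cτ + 1) * Real.sqrt x * L ^ (10 : ℝ)) ^ 2 =
            2 ^ (22 : ℕ) * (Real.sqrt (Cτ + 1)) ^ 2 * (Real.sqrt x * Real.sqrt x) * (L ^ (10 : ℝ)) ^ 2 by ring,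
            Real.sq_sqrt (by positivity), hsx, ← Real.rpow_mul_natCast hL0.le]
          norm_num
        rw [e]
        have h0 : 0 ≤ (Cτ + 1) * x * L ^ (20 : ℝ) := by positivity
        have e2 : (Cτ + 1) * (2 ^ (21 : ℕ) * (x : ℝ) * L ^ (20 : ℝ)) = 2 ^ (21 : ℕ) * ((Cτ + 1) * x * L ^ (20 : ℝ)) := by
          ring
        have e3 : (2 : ℝ) ^ (22 : ℕ) * (Cτ + 1) * x * L ^ (20 : ℝ) = 2 * 2 ^ (21 : ℕ) * ((Cτ + 1) * x * L ^ (20 : ℝ)) := by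
          rw [pow_succ]; ring
        rw [e2, e3]
        have h21 : (0 : ℝ) ≤ 2 ^ (21 : ℕ) := by positivity
        nlinarith only [h0, h21]
      calc _ ≤ Real.sqrt (T ^ 2) := Real.sqrt_le_sqrt (hB.trans hT2)
        _ = T := Real.sqrt_sq hT0
    -- the product
    have hprod : (2 * L ^ (-(17 : ℝ)) * Real.sqrt x + 5 * (x : ℝ) ^ ((1 - δ) / 2)) * T =
        2 ^ (12 : ℕ) * Real.sqrt (Cτ + 1) * ((x : ℝ) / L ^ (7 : ℝ)) +
        5 * 2 ^ (11 : ℕ) * Real.sqrt (Cτ + 1) * ((x : ℝ) ^ (1 - δ / 2) * L ^ (10 : ℝ)) := by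
      have e1 : L ^ (-(17 : ℝ)) * L ^ (10 : ℝ) = 1 / L ^ (7 : ℝ) := by
        rw [← Real.rpow_add hL0, show (-(17 : ℝ)) + 10 = -(7 : ℝ) by norm_num, Real.rpow_neg hL0.le,
          one_div]
      have e2 : (x : ℝ) ^ ((1 - δ) / 2) * Real.sqrt x = (x : ℝ) ^ (1 - δ / 2) := by
        rw [hsx', ← Real.rpow_add hx0]; ring_nf
      calc (2 * L ^ (-(17 : ℝ)) * Real.sqrt x + 5 * (x : ℝ) ^ ((1 - δ) / 2)) * T
          = 2 ^ (12 : ℕ) * Real.sqrt (Cτ + 1) * ((L ^ (-(17 : ℝ)) * L ^ (10 : ℝ)) * (Real.sqrt x * Real.sqrt x)) +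
            5 * 2 ^ (11 : ℕ) * Real.sqrt (Cτ + 1) * (((x : ℝ) ^ ((1 - δ) / 2) * Real.sqrt x) * L ^ (10 : ℝ)) := by
            rw [hT]; ring
        _ = _ := by rw [e1, e2, hsx]; ring
    calc Real.sqrt (4 * ((1 + u) - 1) * y + M + 4 * (1 + u) ^ 2 * (x : ℝ) ^ (1 - δ)) *
          Real.sqrt (Cτ * ((y : ℝ) + 2) * Real.log ((y : ℝ) + 2) ^ (20 : ℕ))
        ≤ (2 * L ^ (-(17 : ℝ)) * Real.sqrt x + 5 * (x : ℝ) ^ ((1 - δ) / 2)) * T :=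
          mul_le_mul hsA hsB (Real.sqrt_nonneg _) (by positivity)
      _ = _ := hprod
      _ ≤ _ := by
          have h0 : 0 ≤ Real.sqrt (Cτ + 1) * ((x : ℝ) / L ^ (7 : ℝ)) := by positivity
          have h1 : 0 ≤ Real.sqrt (Cτ + 1) * ((x : ℝ) ^ (1 - δ / 2) * L ^ (10 : ℝ)) := by positivity
          have e4 : (2 : ℝ) ^ (12 : ℕ) * Real.sqrt (Cτ + 1) * ((x : ℝ) / L ^ (7 : ℝ)) +
              5 * 2 ^ (11 : ℕ) * Real.sqrt (Cτ + 1) * ((x : ℝ) ^ (1 - δ / 2) * L ^ (10 : ℝ)) =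
              4096 * (Real.sqrt (Cτ + 1) * ((x : ℝ) / L ^ (7 : ℝ))) +
              10240 * (Real.sqrt (Cτ + 1) * ((x : ℝ) ^ (1 - δ / 2) * L ^ (10 : ℝ))) := by norm_num; ring
          have e5 : (2 : ℝ) ^ (14 : ℕ) * Real.sqrt (Cτ + 1) * ((x : ℝ) / L ^ (7 : ℝ) +
              (x : ℝ) ^ (1 - δ / 2) * L ^ (10 : ℝ)) =
              16384 * (Real.sqrt (Cτ + 1) * ((x : ℝ) / L ^ (7 : ℝ))) +
              16384 * (Real.sqrt (Cτ + 1) * ((x : ℝ) ^ (1 - δ / 2) * L ^ (10 : ℝ))) := by norm_num; ring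
          rw [e4, e5]
          linarith only [h0, h1]
  exact add_le_add hfirst hsecond

end Summit.Parity.GeneralizedHardyLittlewood.Theorems
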